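import Literature.NumberTheory.LFunctions.ChainCheck
import Literature.NumberTheory.LFunctions.ChainTable
import HarnessLib

/-!
# The colossally abundant chain: certified run, chunk 11 of 32
# (plan N1 of provefact `Literature.NumberTheory.LFunctions.robin_iff`)

Topic: `Literature/NumberTheory/LFunctions`. Pure proof file (a kernel computation; nothing is
asserted). `run11` evaluates `ChainCheck.runD ChainTable.table (4^11) (318000·2⁸⁰) 10000` — at most
`10000` steps of the colossally abundant chain with all its checks (the ratio tests of every level
and Robin's inequality in envelope form at both ends of every step; see `ChainCheck.lean`) — on the
compact state after `100000` steps (the literal on the left: the state recorded by chunk 10) and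
records the resulting compact state (the thresholds `x₁ ≥ x₂ ≥ ⋯` of the exponent levels and the
scaled bounds `Llo, Shi, e, lll, T1hi, ThX`). The meaning of these states is supplied by
`ChainCheck.runD_sound` (`ChainCheckSound.lean`: the invariant `Inv` is preserved), and the 32
chunks (`317075` steps in all, one per prime power entering the chain, up to the prime `4509073`)
are assembled in `RobinCABelow.lean`. The expected states were obtained by evaluating the same
function compiled; they depend on the chunking (`expand` re-seeds the cached logarithms of the
levels at every chunk boundary), so all 32 literals come from one chained evaluation with this chunk
length. The kernel re-derives each here (`decide +kernel`, standard axioms only; about four minutes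
on the gate's machines; `maxHeartbeats 0` lifts the deterministic time-out for this one
declaration).

## References

* G. Robin, *Grandes valeurs de la fonction somme des diviseurs et hypothèse de Riemann*, J. Math.
  Pures Appl. 63 (1984), 187–213, §3 (Prop. 1 and the table of colossally abundant numbers).
  [Robin1984]
-/

namespace Literature.NumberTheory.LFunctions.ChainRun

open ChainCheck ChainTable

set_option maxHeartbeats 0 in
/-- **Chunk 11 of the certified run** of the colossally abundant chain (steps `100000` to `110000`).
[cite: Robin1984, §3 Prop. 1] -/
theorem run11 :
    runD table (4 ^ 11) (318000 * SC) 10000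
      ⟨[1294999, 1571, 151, 43, 19, 13, 7, 7, 5, 3, 3, 3, 3, 3, 2, 2, 2, 2, 2, 2, 2, 2, 2],
        1566217664374515598335976552080,
        3894586315369986673998058,
        66330286583254566,
        3196808648449836281873391,
        1564092744765902416478154791400,
        none⟩ =
    some ⟨[1436111, 1637, 157, 47, 19, 13, 7, 7, 5, 5, 3, 3, 3, 3, 2, 2, 2, 2, 2, 2, 2, 2, 2],
      1736870180639183839918148930330,
      3903440390863481322468482,
      59376335313371263,
      3205649575571264540003694,
      1734634368028958041485770270178,
      none⟩ := by
  decide +kernel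

end Literature.NumberTheory.LFunctions.ChainRun
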